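import Literature.NumberTheory.QuadraticForms.UnitNormIndexSetup
import HarnessLib

/-!
# O'Meara 65:10: the place counts `rank 𝔘 = a + s - 1`, and the unit norm index from step 4

Sibling proof file of `UnitNormIndex.lean`, `UnitNormIndexHerbrand.lean`, `UnitNormIndexSetup.lean`
(namespace `Literature.NumberTheory.QuadraticForms.OMeara65`); all declarations fully proved. With the
notation of O'Meara, *Introduction to quadratic forms*, §65A–B (`S = {v ∉ T}`, `s = |T| + #∞_K`,
`a` / `b` the number of spots of `Ω - S` where `θ` is / is not a local square, `a + b = s`), this
file proves the counts behind step 3 of the proof of Prop. 65:10,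

* `natCard_placesAbove` : `#{w finite, w ∣ T} = |T| + #{v ∈ T | θ ∈ K_v²}` and
  `card_infinitePlace_eq` : `#∞_E = #∞_K + #{w ∣ ∞ | θ ∈ K_w²}` (decomposition law of
  `QuadraticExtensionPlaces.lean`), whence **`rank 𝔘 = a + s - 1`** by Dirichlet's `S`-unit theorem
  for `E` (`finrank_sUnitsAbove`),

and assembles **65:10 from its step 4**: `unitNormIndex_of_kerNorm_le` — if, for the data of
`unitNormIndex K`, every `S_E`-unit of norm `1` is of the form `Γ/σΓ` with `Γ` an `S_E`-unit
(O'Meara's step 4, "`𝔘_N ⊆ T 𝔘`": Hilbert 90 and an adjustment by an element of `F` using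
`J_F = P_F J_F^S`), then `2 · (𝔲 : N_{E/F} 𝔘) = 2^b`, i.e. the named fact `unitNormIndex K` of
`UnitNormIndex.lean` holds: by the Herbrand computation `(𝔘^σ : N 𝔘) · 2^{rk T𝔘} = 2^{rk 𝔲₁}`,
`rk T𝔘 + rk 𝔲₁ = rk 𝔘` of `UnitNormIndexHerbrand.lean`, with `𝔘^σ = 𝔲`, `N 𝔘 = N_{E/F} 𝔘`,
`rk 𝔲₁ = s - 1` (`UnitNormIndexSetup.lean`) and `rk 𝔘 = a + s - 1`.

## References

* O. T. O'Meara, *Introduction to quadratic forms*, Grundlehren 117, Springer (1963), §65A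
  (`a`, `b`, `n_𝔭`), §65B Prop. 65:10 (proof, steps 2–4), PDF pp. 179–185 of the held copy.
-/

noncomputable section

open NumberField IsDedekindDomain Module
open scoped Valued

namespace Literature.NumberTheory.QuadraticForms.OMeara65

variable {K : Type} [Field K] [NumberField K]
variable {E : Type} [Field E] [NumberField E] [Algebra K E]

/-! ### Counting the places of `E` above `T` and above `∞` -/

section Counting

variable (K E) in
/-- `placesAbove K E T` is finite (finitely many places above each `v ∈ T`). [folklore] -/
theorem placesAbove_finite (T : Finset (HeightOneSpectrum (𝓞 K))) : (placesAbove K E T).Finite := by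
  have h : placesAbove K E T = ⋃ v ∈ T, finitePlacesOver E v := by
    ext w
    simp [placesAbove, finitePlacesOver]
  rw [h]
  exact Set.Finite.biUnion T.finite_toSet fun v _ ↦ finitePlacesOver_finite (E := E) v

/-- `#{w ∣ T} = ∑_{v ∈ T} #{w ∣ v}`. [folklore] -/
theorem natCard_placesAbove_eq_sum (T : Finset (HeightOneSpectrum (𝓞 K))) :
    Nat.card (placesAbove K E T) = ∑ v ∈ T, (finitePlacesOver E v).ncard := by
  classical
  rw [Nat.card_coe_set_eq, Set.ncard_eq_toFinset_card _ (placesAbove_finite K E T),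
    Finset.card_eq_sum_card_fiberwise (f := fun w : HeightOneSpectrum (𝓞 E) ↦ w.under (𝓞 K)) (t := T)
      (fun w hw ↦ by simpa [mem_placesAbove_iff] using hw)]
  refine Finset.sum_congr rfl fun v hv ↦ ?_
  rw [← Set.ncard_coe_finset]
  congr 1
  ext w
  simp only [Finset.coe_filter, Set.Finite.mem_toFinset, mem_placesAbove_iff, Set.mem_setOf_eq,
    mem_finitePlacesOver_iff]
  exact ⟨fun h ↦ h.2, fun h ↦ ⟨h ▸ hv, h⟩⟩

/-- `#∞_E = ∑_{v ∣ ∞} #{w ∣ v}`. [folklore] -/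
theorem card_infinitePlace_eq_sum :
    Fintype.card (InfinitePlace E) = ∑ v : InfinitePlace K, (InfinitePlace.placesOver E v).ncard := by
  classical
  rw [← Finset.card_univ,
    Finset.card_eq_sum_card_fiberwise (f := fun w : InfinitePlace E ↦ w.comap (algebraMap K E))
      (t := Finset.univ) (fun _ _ ↦ Finset.mem_univ _)]
  refine Finset.sum_congr rfl fun v _ ↦ ?_
  rw [← Set.ncard_coe_finset]
  congr 1
  ext w
  simp only [Finset.coe_filter, Finset.mem_univ, true_and, Set.mem_setOf_eq]
  exact (QuadraticForms.InfinitePlace.mem_placesOver_iff_comap_eq).symm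

variable [Algebra.IsQuadraticExtension K E] {a : K} {α : E}

open scoped Classical in
/-- **`#{w ∣ T} = |T| + #{v ∈ T | a ∈ K_v²}`** for `E = K(√a)` (decomposition law: two places above
`v` if `a ∈ K_v²`, one otherwise). [cite: Omeara1963, §65A] -/
theorem natCard_placesAbove (hα : α ^ 2 = algebraMap K E a) (hαK : ∀ r : K, algebraMap K E r ≠ α)
    (T : Finset (HeightOneSpectrum (𝓞 K))) :
    Nat.card (placesAbove K E T) =
      T.card + (T.filter fun v ↦ IsSquare (algebraMap K (v.adicCompletion K) a)).card := by
  rw [natCard_placesAbove_eq_sum]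
  have h : ∀ v ∈ T, (finitePlacesOver E v).ncard =
      if IsSquare (algebraMap K (v.adicCompletion K) a) then 2 else 1 := fun v _ ↦ by
    split_ifs with hsq
    · exact (QuadraticExtension.ncard_finitePlacesOver_eq_two_iff_isSquare hα hαK v).2 hsq
    · exact (QuadraticExtension.ncard_finitePlacesOver_eq_one_iff_not_isSquare hα hαK v).2 hsq
  rw [Finset.sum_congr rfl h, Finset.sum_ite, Finset.sum_const, Finset.sum_const, smul_eq_mul,
    smul_eq_mul, mul_one]
  have := Finset.card_filter_add_card_filter_not
    (p := fun v ↦ IsSquare (algebraMap K (v.adicCompletion K) a)) (s := T)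
  omega

open scoped Classical in
/-- **`#∞_E = #∞_K + #{v ∣ ∞ | a ∈ K_v²}`** for `E = K(√a)` (decomposition law at the infinite
places). [cite: Omeara1963, §65A] -/
theorem card_infinitePlace_eq (hα : α ^ 2 = algebraMap K E a) (hαK : ∀ r : K, algebraMap K E r ≠ α) :
    Fintype.card (InfinitePlace E) = Fintype.card (InfinitePlace K) +
      (Finset.univ.filter fun v : InfinitePlace K ↦ IsSquare (algebraMap K v.Completion a)).card := by
  rw [card_infinitePlace_eq_sum (K := K)]
  have h : ∀ v ∈ (Finset.univ : Finset (InfinitePlace K)), (InfinitePlace.placesOver E v).ncard =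
      if IsSquare (algebraMap K v.Completion a) then 2 else 1 := fun v _ ↦ by
    split_ifs with hsq
    · exact (QuadraticExtension.ncard_infinitePlacesOver_eq_two_iff_isSquare hα hαK v).2 hsq
    · exact (QuadraticExtension.ncard_infinitePlacesOver_eq_one_iff_not_isSquare hα hαK v).2 hsq
  rw [Finset.sum_congr rfl h, Finset.sum_ite, Finset.sum_const, Finset.sum_const, smul_eq_mul,
    smul_eq_mul, mul_one, ← Finset.card_univ]
  have := Finset.card_filter_add_card_filter_not
    (p := fun v : InfinitePlace K ↦ IsSquare (algebraMap K v.Completion a)) (s := Finset.univ)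
  omega

open scoped Classical in
/-- **`rank 𝔘 = a + s - 1`** (O'Meara, step 3: "`𝔘` has rank `a + s - 1` by the Dirichlet Unit
Theorem"), in the form `rk 𝔘 + 1 = |T| + #∞_K + a_f + a_∞` with `a_f`, `a_∞` the numbers of finite
places in `T`, resp. infinite places, where `a` is a local square.
[cite: Omeara1963, §65B Prop. 65:10 (proof, step 3)] -/
theorem finrank_sUnitsAbove (hα : α ^ 2 = algebraMap K E a) (hαK : ∀ r : K, algebraMap K E r ≠ α)
    (T : Finset (HeightOneSpectrum (𝓞 K))) :
    finrank ℤ (Additive (sUnitsAbove K E T)) + 1 =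
      T.card + Fintype.card (InfinitePlace K) +
        (T.filter fun v ↦ IsSquare (algebraMap K (v.adicCompletion K) a)).card +
        (Finset.univ.filter fun v : InfinitePlace K ↦ IsSquare (algebraMap K v.Completion a)).card := by
  haveI : Finite (placesAbove K E T) := (placesAbove_finite K E T).to_subtype
  rw [sUnitsAbove, DiophantineGeometry.NumberField.finrank_sUnit, natCard_placesAbove hα hαK, Units.rank,
    card_infinitePlace_eq hα hαK]
  have : 1 ≤ Fintype.card (InfinitePlace K) := Fintype.card_pos
  omega

end Counting

/-! ### 65:10 from its step 4 -/

section Assembly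

variable (K) in
/-- **O'Meara 65:10 from step 4 of its proof.** If for all the data of `unitNormIndex K` the
`S_E`-units of norm `1` are quotients `Γ/σΓ` of `S_E`-units (`𝔘_N ⊆ T 𝔘`, step 4 of the book),
then `2 · (𝔲 : N_{E/F} 𝔘) = 2^b`, i.e. the named fact `unitNormIndex K` (`UnitNormIndex.lean`)
holds. Steps 1–3 are `relIndex_normEnd_mul_two_pow` / `finrank_quotEnd_range_add`
(`UnitNormIndexHerbrand.lean`) for `G = 𝔘`, `U₁ = 𝔲₁`, `ε = -1`, combined with `𝔘^σ = 𝔲`,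
`N 𝔘 = N_{E/F} 𝔘`, `rk 𝔲₁ = rank K + |T|` (`UnitNormIndexSetup.lean`) and
`rk 𝔘 + 1 = |T| + #∞_K + a` (`finrank_sUnitsAbove`).
[cite: Omeara1963, §65B Prop. 65:10] -/
theorem unitNormIndex_of_kerNorm_le
    (h4 : ∀ (T : Finset (HeightOneSpectrum (𝓞 K))), ContainsDyadic K T → IsAdmissible K T →
      ∀ (a : K), (∀ v ∉ T, v.valuation K a = 1) →
        ∀ (E : Type) [Field E] [NumberField E] [Algebra K E] [Algebra.IsQuadraticExtension K E]
          (α : E), α ^ 2 = algebraMap K E a → (∀ r : K, algebraMap K E r ≠ α) →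
          ∀ (σ : E ≃ₐ[K] E), σ ≠ 1 →
            (normEnd (conjSUnits T σ)).ker ≤ (quotEnd (conjSUnits T σ)).range) :
    unitNormIndex K := by
  intro T hT hadm a haT E _ _ _ _ α hα hαK
  classical
  obtain ⟨σ, hσ⟩ := QuadraticExtension.exists_algEquiv_ne_one (K := K) (E := E)
  have hσσ : ∀ g : sUnitsAbove K E T, conjSUnits T σ (conjSUnits T σ g) = g :=
    conjSUnits_conjSUnits (QuadraticExtension.algEquiv_mul_self hσ)
  haveI : Finite (placesAbove K E T) := (placesAbove_finite K E T).to_subtype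
  have hA := relIndex_normEnd_mul_two_pow hσσ (negOne_ne_one T)
    (negOne_mem_range_quotEnd hσ haT hα hαK) sq_eq_one_iff_sUnits
    (U₁ := powSUnits E T) (fun u hu ↦ conjSUnits_eq_of_mem_powSUnits σ hu)
    (relIndex_powSUnits_ne_zero hσ) (fun u hu h ↦ powSUnits_sq_eq_one hu h)
    (h4 T hT hadm a haT E α hα hαK σ hσ)
  have hB := finrank_quotEnd_range_add hσσ (U₁ := powSUnits E T)
    (fun u hu ↦ conjSUnits_eq_of_mem_powSUnits σ hu) (relIndex_powSUnits_ne_zero hσ)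
    (fun u hu h ↦ powSUnits_sq_eq_one hu h)
  rw [relIndex_normEnd_conjSUnits hσ] at hA
  rw [finrank_powSUnits] at hA hB
  have hG := finrank_sUnitsAbove hα hαK T
  set r := (normSUnits K E T).relIndex ((↑T : Set (HeightOneSpectrum (𝓞 K))).unit K)
  set t := finrank ℤ (Additive (quotEnd (conjSUnits T σ)).range)
  set x := (T.filter fun v ↦ IsSquare (algebraMap K (v.adicCompletion K) a)).card
  set y := (Finset.univ.filter fun v : InfinitePlace K ↦ IsSquare (algebraMap K v.Completion a)).card
  have hx := Finset.card_filter_add_card_filter_not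
    (p := fun v ↦ IsSquare (algebraMap K (v.adicCompletion K) a)) (s := T)
  have hy := Finset.card_filter_add_card_filter_not
    (p := fun v : InfinitePlace K ↦ IsSquare (algebraMap K v.Completion a)) (s := Finset.univ)
  have hrank : Units.rank K + 1 = Fintype.card (InfinitePlace K) := by
    have : 1 ≤ Fintype.card (InfinitePlace K) := Fintype.card_pos
    rw [Units.rank]; omega
  -- `t = x + y` and `bCard = (|T| - x) + (#∞_K - y)`
  have ht : t = x + y := by omega
  have hb : bCard K a T + t = Units.rank K + T.card + 1 := by
    rw [bCard, Finset.card_univ] at *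
    omega
  have key : 2 * r * 2 ^ t = 2 ^ bCard K a T * 2 ^ t := by
    rw [mul_assoc, hA, ← pow_succ', ← pow_add, hb]
  exact Nat.eq_of_mul_eq_mul_right (by positivity) key

end Assembly

end Literature.NumberTheory.QuadraticForms.OMeara65
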